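import Summits.Ventures.HSemireg.Mod4BranchGValuation

/-!
# Venture HSemireg — MOD-4 OFF THE SPLIT FAMILY: the `p`-adic core of LEMMA ν, part 3 (every dimension `2n`;
# the EIGHTFOLD case `n = 4`) — row (F-4) of the W3 table; seat `w3-mod4-1`, files of record
# `widen/W3/MOD4-OFFSPLIT-w3mod4.md` (v1.1 §9: the eightfold K′-secant statement), `widen/W3/MOD4-OFFSPLIT-THEOREMS-w3mod4.md`

HONEST FRAMING. Lean index of the computation cell `pub-hsemireg`, widening seat `w3-mod4-1`; companion of
`Mod4SecantValuation.lean` (part 1) and `Mod4BranchGValuation.lean` (part 2).  ELEMENTARY `p`-ADIC ARITHMETIC OF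
RATIONAL NUMBERS ONLY: no abelian variety, no sheaf, no Mukai vector, no Ext group and no semiregularity map is
constructed here; the geometric inputs (LEMMA PIN, LEMMA HRR-SPLIT, TABLE R at `n = 4`, LEMMA RR-FIBRE at the eightfold
product frames, the frames' `Λ_W` value sets) are NOT formalised.  Nothing here says that HC, HC_CM or HC_AV holds,
and nothing here is a new case of anything.

*What it indexes (on paper, NOT in this file).* On a Weil `2n`-fold the Mukai self-pairing of a K′-secant h-part
`f(h) = x e^{μh} + x̄ e^{μ̄h}` is `(f,f)_χ = D · P_f(q)` with
`P_f(q) = Σ_{j ≤ 2n} (-1)^j C(2n,j) q_j q_{2n-j} = (2n)! · [h^{2n}] f(h) f(-h) = 2 (-1)^n Δ^n Nm(x) = 2 (-1)^n Δ^{n-1} ·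
Nm(q₁ - q₀ μ̄)`; the sixfold case is `ν(f) = -P_f/2` (parts 1–2), the EIGHTFOLD case `n = 4` reads
`P_f(q) = 2 Δ³ · Nm(q₁ - q₀ μ̄)` (`half_Pf8_eq` below).  The skeleton and both field cases of parts 1–2 go through
verbatim with `(q₅, q₆, Δ², p⁻²) ↦ (q_{2k+1}, q_{2k+2}, Δ^k, p^{-k})`, `k = n - 1`; at `k = 3` this is the input
«`v_p(Δ³ · Nm(q₁ - q₀ μ̄)) ≥ 3` at every ramified prime `p` of `K′`, once `q₀, q₁, q₇, q₈ ∈ ℤ_(p)`» of the eightfold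
K′-secant statement of the seat file (v1.1 §9: on the five eightfold CM frames of record Branch G needs
`(w,w)_χ = 6 - 2 D Δ³ Nm(q₁ - q₀ μ̄) ∈ (0, 6)`, a finite list per frame, and no listed value of `Δ³ Nm(q₁ - q₀ μ̄)` has
valuation `≥ 3` at any prime — a per-frame check done on paper there, not here).

CONTENT (all PROVED, 0 sorry, no definitions, no named facts), namespace `Summit.Ventures.HSemireg.Mod4`:
* `half_Pf8_eq` — the eightfold pencil identity `P_f(q)/2 = (4P - S²)³ · Nm(q₁ - q₀ μ̄)`;
* `norm_nu_le_general` — the skeleton in every dimension: `q₀, q₁, q_{2k+1}, q_{2k+2} ∈ ℤ_(p)` and the slope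
  conditions (A0), (B), (A) give `|(4P - S²)^k · Nm(q₁ - q₀ μ̄)|_p ≤ p^{-k}`;
* `lemma_nu_ramified_general` (`|m|_p = p⁻¹`, any prime `p`) and `lemma_nu_two_general` (`p = 2`, `m ≡ 1 mod 4`) —
  **LEMMA ν in every dimension**; `k = 2` recovers parts 1–2, `k = 3` is the eightfold input.
-/

namespace Summit.Ventures.HSemireg

namespace Mod4

variable {p : ℕ} [hp : Fact p.Prime]

section Helpers

/-! ### File-private copies of four one-line `padicNorm` wrappers of part 1 -/

/-- The `p`-adic norm of a power (Mathlib's `IsAbsoluteValue.abv_pow`). -/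
private theorem norm_pow (x : ℚ) (n : ℕ) : padicNorm p (x ^ n) = padicNorm p x ^ n :=
  IsAbsoluteValue.abv_pow (padicNorm p) x n

/-- `|x^n|_p ≤ 1` from `|x|_p ≤ 1`. -/
private theorem norm_pow_le_one {x : ℚ} (hx : padicNorm p x ≤ 1) (n : ℕ) : padicNorm p (x ^ n) ≤ 1 := by
  rw [norm_pow]; exact pow_le_one₀ (padicNorm.nonneg _) hx

/-- Nonarchimedean bound for a sum. -/
private theorem norm_add_le {x y t : ℚ} (hx : padicNorm p x ≤ t) (hy : padicNorm p y ≤ t) :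
    padicNorm p (x + y) ≤ t :=
  le_trans padicNorm.nonarchimedean (max_le hx hy)

/-- Nonarchimedean bound for a difference. -/
private theorem norm_sub_le {x y t : ℚ} (hx : padicNorm p x ≤ t) (hy : padicNorm p y ≤ t) :
    padicNorm p (x - y) ≤ t :=
  le_trans padicNorm.sub (max_le hx hy)

end Helpers

section GeneralDegree

/-! ### Every dimension `2n = 2k + 2`: `v_p(Δ^k · Nm(q₁ - q₀ μ̄)) ≥ k` from `q₀, q₁, q_{2k+1}, q_{2k+2} ∈ ℤ_(p)`

On a Weil `2n`-fold the Mukai self-pairing of a K′-secant h-part is `(f,f)_χ = D · P_f(q)` with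
`P_f(q) = Σ_{j ≤ 2n} (-1)^j C(2n,j) q_j q_{2n-j} = (2n)! · [h^{2n}] f(h) f(-h) = 2 (-1)^n Δ^n Nm(x) = 2 (-1)^n Δ^{n-1} ·
Nm(q₁ - q₀ μ̄)`; the sixfold case `n = 3` is `ν(f) = -P_f/2` above, the EIGHTFOLD case `n = 4` (`k = 3`) reads
`P_f(q) = 2 Δ³ · Nm(q₁ - q₀ μ̄)` (`half_Pf8_eq`).  The skeleton and both field cases go through verbatim with
`(5, 6, Δ², p⁻²) ↦ (2k+1, 2k+2, Δ^k, p^{-k})`; at `k = 3` this is the input «`v_p(Δ³ Nm(q₁ - q₀ μ̄)) ≥ 3`» of the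
eightfold K′-secant statement of the seat file (v1.1 §9), whose remaining step is a finite per-frame check on paper. -/

/-- The eightfold pencil identity: with `P_f(q) = Σ_{j=0}^{8} (-1)^j C(8,j) q_j q_{8-j}` one has
`P_f(q)/2 = (4P - S²)³ · Nm(q₁ - q₀ μ̄)` (so `(f,f)_χ = 2 D Δ³ Nm(q₁ - q₀ μ̄) > 0` for an imaginary quadratic `K′`). -/
theorem half_Pf8_eq (S P r q₁ : ℚ) :
    (qseq S P r q₁ 0 * qseq S P r q₁ 8 - 8 * (qseq S P r q₁ 1 * qseq S P r q₁ 7)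
        + 28 * (qseq S P r q₁ 2 * qseq S P r q₁ 6) - 56 * (qseq S P r q₁ 3 * qseq S P r q₁ 5)
        + 70 * (qseq S P r q₁ 4 * qseq S P r q₁ 4) - 56 * (qseq S P r q₁ 5 * qseq S P r q₁ 3)
        + 28 * (qseq S P r q₁ 6 * qseq S P r q₁ 2) - 8 * (qseq S P r q₁ 7 * qseq S P r q₁ 1)
        + qseq S P r q₁ 8 * qseq S P r q₁ 0) / 2
      = (4 * P - S ^ 2) ^ 3 * normForm S P r q₁ := by
  simp only [qseq, normForm]
  ring

/-- **Skeleton of LEMMA ν in every dimension.**  If `q₀, q₁, q_{2k+1}, q_{2k+2} ∈ ℤ_(p)` and the slope data satisfy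
(A0), (B), (A) as in `norm_nu_le_of_cases`, then `|(4P - S²)^k · Nm(q₁ - q₀ μ̄)|_p ≤ p^{-k}` (`k = n - 1`; `k = 2` is
`norm_nu_le_of_cases`, `k = 3` is the eightfold case). -/
theorem norm_nu_le_general (k : ℕ) (S P r q₁ : ℚ)
    (hr : padicNorm p r ≤ 1) (hq₁ : padicNorm p q₁ ≤ 1)
    (hq : padicNorm p (qseq S P r q₁ (2 * k + 1)) ≤ 1) (hq' : padicNorm p (qseq S P r q₁ (2 * k + 2)) ≤ 1)
    (hA0 : padicNorm p P ≤ 1 → padicNorm p S ≤ 1)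
    (hB : padicNorm p P ≤ 1 → padicNorm p S ≤ 1 → padicNorm p (4 * P - S ^ 2) ≤ (p : ℚ)⁻¹)
    (hA : 1 < padicNorm p P → padicNorm p S ^ 2 ≤ padicNorm p P) :
    padicNorm p ((4 * P - S ^ 2) ^ k * normForm S P r q₁) ≤ ((p : ℚ) ^ k)⁻¹ := by
  have hp0 : (0 : ℚ) < p := by exact_mod_cast hp.out.pos
  rcases le_or_gt (padicNorm p P) 1 with hP | hP
  · have hS : padicNorm p S ≤ 1 := hA0 hP
    have hΔ : padicNorm p (4 * P - S ^ 2) ≤ (p : ℚ)⁻¹ := hB hP hS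
    have hN : padicNorm p (normForm S P r q₁) ≤ 1 := by
      unfold normForm
      refine norm_add_le (norm_sub_le (norm_pow_le_one hq₁ 2) ?_) ?_
      · exact norm_mul_le_left (norm_mul_le_left hS hr) hq₁
      · exact norm_mul_le_left hP (norm_pow_le_one hr 2)
    rw [padicNorm.mul, norm_pow]
    calc padicNorm p (4 * P - S ^ 2) ^ k * padicNorm p (normForm S P r q₁)
        ≤ ((p : ℚ)⁻¹) ^ k * 1 := by
          apply mul_le_mul _ hN (padicNorm.nonneg _) (by positivity)
          exact pow_le_pow_left₀ (padicNorm.nonneg _) hΔ k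
      _ = ((p : ℚ) ^ k)⁻¹ := by rw [mul_one, inv_pow]
  · have hPpos : 0 < padicNorm p P := lt_trans one_pos hP
    have hpP : (p : ℚ) ≤ padicNorm p P := p_le_norm_of_one_lt hP
    have hS2 : padicNorm p S ^ 2 ≤ padicNorm p P := hA hP
    have hS1 : padicNorm p S ≤ padicNorm p P := by
      rcases le_or_gt (padicNorm p S) 1 with h1 | h1
      · exact le_trans h1 (le_of_lt hP)
      · calc padicNorm p S = padicNorm p S * 1 := (mul_one _).symm
          _ ≤ padicNorm p S * padicNorm p S :=
              mul_le_mul_of_nonneg_left (le_of_lt h1) (padicNorm.nonneg _)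
          _ = padicNorm p S ^ 2 := (sq _).symm
          _ ≤ padicNorm p P := hS2
    have h4 : padicNorm p (4 : ℚ) ≤ 1 := by exact_mod_cast padicNorm.of_nat (p := p) 4
    have hΔ : padicNorm p (4 * P - S ^ 2) ≤ padicNorm p P := by
      refine norm_sub_le (norm_mul_le_right h4 le_rfl) ?_
      rw [norm_pow]; exact hS2
    have hN'' : padicNorm p (normForm S P (qseq S P r q₁ (2 * k + 1)) (qseq S P r q₁ (2 * k + 1 + 1)))
        ≤ padicNorm p P := by
      unfold normForm
      refine norm_add_le (norm_sub_le ?_ ?_) ?_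
      · exact le_trans (norm_pow_le_one hq' 2) (le_of_lt hP)
      · exact norm_mul_le_left (norm_mul_le_left hS1 hq) hq'
      · exact norm_mul_le_left le_rfl (norm_pow_le_one hq 2)
    have hid := normForm_qseq S P r q₁ (2 * k + 1)
    have hN' : padicNorm p (normForm S P r q₁) * padicNorm p P ^ (2 * k + 1) ≤ padicNorm p P := by
      calc padicNorm p (normForm S P r q₁) * padicNorm p P ^ (2 * k + 1)
          = padicNorm p (P ^ (2 * k + 1) * normForm S P r q₁) := by rw [padicNorm.mul, norm_pow, mul_comm]
        _ = padicNorm p (normForm S P (qseq S P r q₁ (2 * k + 1)) (qseq S P r q₁ (2 * k + 1 + 1))) := by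
            rw [hid]
        _ ≤ padicNorm p P := hN''
    have hN'2 : padicNorm p (normForm S P r q₁) ≤ padicNorm p P / padicNorm p P ^ (2 * k + 1) := by
      rw [le_div_iff₀ (by positivity)]; exact hN'
    rw [padicNorm.mul, norm_pow]
    calc padicNorm p (4 * P - S ^ 2) ^ k * padicNorm p (normForm S P r q₁)
        ≤ padicNorm p P ^ k * (padicNorm p P / padicNorm p P ^ (2 * k + 1)) := by
          apply mul_le_mul _ hN'2 (padicNorm.nonneg _) (by positivity)
          exact pow_le_pow_left₀ (padicNorm.nonneg _) hΔ k
      _ = (padicNorm p P ^ k)⁻¹ := by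
          field_simp
          ring
      _ ≤ ((p : ℚ) ^ k)⁻¹ := by
          apply inv_anti₀ (by positivity)
          exact pow_le_pow_left₀ (le_of_lt hp0) hpP k

/-- **LEMMA ν in every dimension, ramified prime** (`|m|_p = p⁻¹`): `p`-integrality of `q₀, q₁, q_{2k+1}, q_{2k+2}`
gives `|Δ^k · Nm(q₁ - q₀ μ̄)|_p ≤ p^{-k}`.  At `k = 3` (eightfolds): `v_p(Δ³ Nm(q₁ - q₀ μ̄)) ≥ 3`. -/
theorem lemma_nu_ramified_general (k : ℕ) (m a b r q₁ : ℚ) (hm : padicNorm p m = (p : ℚ)⁻¹)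
    (hr : padicNorm p r ≤ 1) (hq₁ : padicNorm p q₁ ≤ 1)
    (hq : padicNorm p (qseq (2 * a) (a ^ 2 + m * b ^ 2) r q₁ (2 * k + 1)) ≤ 1)
    (hq' : padicNorm p (qseq (2 * a) (a ^ 2 + m * b ^ 2) r q₁ (2 * k + 2)) ≤ 1) :
    padicNorm p ((4 * m * b ^ 2) ^ k * normForm (2 * a) (a ^ 2 + m * b ^ 2) r q₁)
      ≤ ((p : ℚ) ^ k)⁻¹ := by
  have hΔ : 4 * m * b ^ 2 = 4 * (a ^ 2 + m * b ^ 2) - (2 * a) ^ 2 := by ring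
  have h4 : padicNorm p (4 : ℚ) ≤ 1 := by exact_mod_cast padicNorm.of_nat (p := p) 4
  have hSP := ramified_norm_S_sq_le (p := p) m a b hm
  rw [hΔ]
  refine norm_nu_le_general k _ _ r q₁ hr hq₁ hq hq' ?_ ?_ ?_
  · intro hP
    have h' : padicNorm p (2 * a) ^ 2 ≤ 1 := le_trans hSP (norm_mul_le_right h4 hP)
    exact (pow_le_one_iff_of_nonneg (padicNorm.nonneg _) two_ne_zero).mp h'
  · intro hP hS
    exact ramified_norm_delta_le m a b hm hP hS
  · intro _
    exact le_trans hSP (norm_mul_le_right h4 le_rfl)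

/-- **LEMMA ν in every dimension, `p = 2`, `m ≡ 1 (mod 4)`**: `2`-integrality of `q₀, q₁, q_{2k+1}, q_{2k+2}` gives
`|Δ^k · Nm(q₁ - q₀ μ̄)|₂ ≤ 2^{-k}`.  At `k = 3` (eightfolds over `ℚ(i)`): `v_2(Δ³ Nm(q₁ - q₀ μ̄)) ≥ 3`. -/
theorem lemma_nu_two_general (k : ℕ) (m a b r q₁ : ℚ) (hm : padicNorm 2 (m - 1) ≤ 4⁻¹)
    (hr : padicNorm 2 r ≤ 1) (hq₁ : padicNorm 2 q₁ ≤ 1)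
    (hq : padicNorm 2 (qseq (2 * a) (a ^ 2 + m * b ^ 2) r q₁ (2 * k + 1)) ≤ 1)
    (hq' : padicNorm 2 (qseq (2 * a) (a ^ 2 + m * b ^ 2) r q₁ (2 * k + 2)) ≤ 1) :
    padicNorm 2 ((4 * m * b ^ 2) ^ k * normForm (2 * a) (a ^ 2 + m * b ^ 2) r q₁)
      ≤ ((2 : ℚ) ^ k)⁻¹ := by
  have hΔ : 4 * m * b ^ 2 = 4 * (a ^ 2 + m * b ^ 2) - (2 * a) ^ 2 := by ring
  rw [hΔ]
  have hB : padicNorm 2 (a ^ 2 + m * b ^ 2) ≤ 1 → padicNorm 2 (2 * a) ≤ 1 →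
      padicNorm 2 (4 * (a ^ 2 + m * b ^ 2) - (2 * a) ^ 2) ≤ ((2 : ℕ) : ℚ)⁻¹ := by
    intro hP _
    exact_mod_cast two_norm_delta_le hm hP
  have h := norm_nu_le_general (p := 2) k (2 * a) (a ^ 2 + m * b ^ 2) r q₁ hr hq₁ hq hq'
    (fun hP => two_norm_S_le hm hP) hB (fun _ => two_norm_S_sq_le hm a b)
  exact_mod_cast h

end GeneralDegree

end Mod4

end Summit.Ventures.HSemireg
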